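import Summits.SmoothPoincare4.SmoothPoincare4.Theses.SblfDescent
import Literature.Topology.FourManifolds.SimplifiedBrokenLefschetzFibration
import Literature.AlgebraicTopology.SingularHomology.ExcisionMayerVietorisProofs
import Literature.Topology.FourManifolds.HomotopyS4CompactProofs
import Literature.Topology.FourManifolds.HomotopyS4SimplyConnected
import Literature.Topology.FourManifolds.SphereSimplyConnected

/-!
# SmoothPoincare4 / SblfDescent — the genus-one rung `RungOne`, modulo Hayano's classification

Support item stmt-SmoothPoincare4-18531 of route SblfDescent: a smooth homotopy 4-sphere `M`
carrying a simplified broken Lefschetz fibration of lower genus `0` (genus `1`, non-empty round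
locus; the route's inline predicate `HAS(M, 0)`) is diffeomorphic to `S⁴`.

This is a PUBLISHED theorem (Hayano 2011, Cor. 4.11 / Main Theorem B at `r = 0`; Baykur–Kamada
2015, Lemma 11 with Cor. 14; Baykur 2012, p. 18), recorded in the tree as the named fact
`Literature.Topology.FourManifolds.nonempty_diffeomorph_sphere_four_of_sblf_genus_one` over the
vocabulary `Literature.Topology.FourManifolds.IsSimplifiedBrokenLefschetzFibration`.  Here we prove
the item CONDITIONALLY on that fact (`RungOne_of_sblfGenusOne`): a homotopy 4-sphere is compact
(`compactSpace_of_homotopyEquiv_sphere_four_holds`), simply connected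
(`simplyConnectedSpace_of_homotopyEquiv_sphere_four` with `simplyConnectedSpace_sphere_four_holds`)
and has `H₂(M; ℤ) ≅ H₂(S⁴; ℤ) = 0` (homotopy invariance `singularHomology.isoOfHomotopyEquiv` and
`isZero_singularHomology_unitSphere`), and the route's inline `HAS(M, 0)` is field-for-field the
structure `IsSimplifiedBrokenLefschetzFibration o f L 0`.  The item closes when the fact is
discharged (`…_holds`), which is an XL formalisation (Kirby calculus of genus-1 SBLFs).
-/

-- `Summit.SmoothPoincare4.SmoothPoincare4.…` (summit = problem) trips `dupNamespace` on every decl.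
set_option linter.dupNamespace false

namespace Summit.SmoothPoincare4.SmoothPoincare4.Theorems

open scoped Manifold ContDiff Topology ContinuousMap
open CategoryTheory Limits

/-- **`RungOne` modulo Hayano's genus-one classification.**  GIVEN the named fact
`nonempty_diffeomorph_sphere_four_of_sblf_genus_one` (Hayano 2011, Cor. 4.11 in the case
`H₂ = 0`; Baykur–Kamada 2015, Lemma 11 + Cor. 14: a closed simply connected smooth 4-manifold with
`H₂(X; ℤ) = 0` carrying a genus-1 SBLF with non-empty round locus is `S⁴`), the route decl
`RungOne` holds: for `M ≃ₕ S⁴` we supply compactness, simple connectivity and `H₂(M; ℤ) = 0` from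
tree theorems and repackage the route's inline `HAS(M, 0)` as
`IsSimplifiedBrokenLefschetzFibration o f L 0` (the fields are the clauses, in order).
CONDITIONAL result: credits nothing until the fact is discharged. [cite: Hayano2011, Cor. 4.11] -/
theorem RungOne_of_sblfGenusOne
    (H : Literature.Topology.FourManifolds.nonempty_diffeomorph_sphere_four_of_sblf_genus_one) :
    Summit.SmoothPoincare4.SmoothPoincare4.Theses.SblfDescent.RungOne := by
  intro M _ _ _ _ _ e hM
  obtain ⟨o, f, L, h1, h2, h3, h4, h5, h6, h7, h8, h9, h10⟩ := hM
  haveI : CompactSpace M :=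
    Literature.Topology.FourManifolds.compactSpace_of_homotopyEquiv_sphere_four_holds M e
  haveI : SimplyConnectedSpace M :=
    Literature.Topology.FourManifolds.simplyConnectedSpace_of_homotopyEquiv_sphere_four
      Literature.Topology.FourManifolds.simplyConnectedSpace_sphere_four_holds M e
  have hH2 : IsZero (Literature.AlgebraicTopology.SingularHomology.singularHomology ℤ ℤ M 2) :=
    (Literature.AlgebraicTopology.SingularHomology.isZero_singularHomology_unitSphere ℤ ℤ 4 2
        (by norm_num) (by norm_num)).of_iso
      (Literature.AlgebraicTopology.SingularHomology.singularHomology.isoOfHomotopyEquiv ℤ ℤ e 2)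
  exact H M hH2 ⟨o, f, L, ⟨h1, h2, h3, h4, h5, h6, h7, h8, h9, h10⟩⟩

/-- Conversely to the packaging above, the route's inline predicate `HAS(M, 0)` of `RungOne` is
EXACTLY `∃ o f L, IsSimplifiedBrokenLefschetzFibration o f L 0` (so the named fact is used at its
face value, not at a weakening): the two existentials are interderivable field by field.
[folklore] -/
theorem sblfDescent_has_zero_iff (M : Type) [TopologicalSpace M]
    [ChartedSpace (EuclideanSpace ℝ (Fin 4)) M] [IsManifold (𝓡 4) ∞ M] :
    (∃ (o : Literature.Topology.FourManifolds.SmoothOrientation (𝓡 4) M)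
        (f : M → Metric.sphere (0 : EuclideanSpace ℝ (Fin 3)) 1) (L : Finset M),
        Literature.Topology.FourManifolds.IsSimplifiedBrokenLefschetzFibration o f L 0) ↔
    (∃ (o : Literature.Topology.FourManifolds.SmoothOrientation (𝓡 4) M) (f : M → (Metric.sphere (0 : EuclideanSpace ℝ (Fin 3)) 1)) (L : Finset M), let R : M → Prop := fun q => Function.Surjective (mfderiv (𝓡 4) (𝓡 2) f q); let G : (Metric.sphere (0 : EuclideanSpace ℝ (Fin 3)) 1) → ℕ → Prop := fun y n => Nonempty ((Fin (2 * n) → ℤ) ≃ₗ[ℤ] Literature.AlgebraicTopology.SingularHomology.singularHomology ℤ ℤ ↥(f ⁻¹' {y}) 1); ContMDiff (𝓡 4) (𝓡 2) ((⊤ : ℕ∞) : WithTop ℕ∞) f ∧ Function.Surjective f ∧ (∀ p ∈ L, Literature.Topology.FourManifolds.IsLefschetzCriticalPoint (𝓡 4) (𝓡 2) o f p true) ∧ (∀ p : M, ¬ R p → p ∉ L → ∃ (φ : OpenPartialHomeomorph M (EuclideanSpace ℝ (Fin 4))) (ψ : OpenPartialHomeomorph (Metric.sphere (0 : EuclideanSpace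 ℝ (Fin 3)) 1) (EuclideanSpace ℝ (Fin 2))), p ∈ φ.source ∧ φ p = 0 ∧ Set.MapsTo f φ.source ψ.source ∧ ContMDiffOn (𝓡 4) (𝓡 4) ((⊤ : ℕ∞) : WithTop ℕ∞) φ φ.source ∧ ContMDiffOn (𝓡 4) (𝓡 4) ((⊤ : ℕ∞) : WithTop ℕ∞) φ.symm φ.target ∧ ContMDiffOn (𝓡 2) (𝓡 2) ((⊤ : ℕ∞) : WithTop ℕ∞) ψ ψ.source ∧ ContMDiffOn (𝓡 2) (𝓡 2) ((⊤ : ℕ∞) : WithTop ℕ∞) ψ.symm ψ.target ∧ ∀ q ∈ φ.source, (ψ (f q)) 0 = (φ q) 0 ∧ (ψ (f q)) 1 = (φ q) 1 ^ 2 + (φ q) 2 ^ 2 - (φ q) 3 ^ 2) ∧ IsConnected ({p : M | ¬ R p} \ (↑L : Set M)) ∧ Set.InjOn f {p : M | ¬ R p} ∧ (∀ y, (∀ q, f q = y → R q) → IsConnected (f ⁻¹' {y}) ∧ (G y (0 + 1) ∨ G y (0))) ∧ (∃ y, (∀ q, f q = y → R q) ∧ G y (0 + 1)) ∧ (∃ y,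 (∀ q, f q = y → R q) ∧ G y (0)) ∧ (∀ p ∈ L, ∀ᶠ y in nhds (f p), (∀ q, f q = y → R q) → G y (0 + 1))) := by
  constructor
  · rintro ⟨o, f, L, ⟨h1, h2, h3, h4, h5, h6, h7, h8, h9, h10⟩⟩
    exact ⟨o, f, L, h1, h2, h3, h4, h5, h6, h7, h8, h9, h10⟩
  · rintro ⟨o, f, L, h1, h2, h3, h4, h5, h6, h7, h8, h9, h10⟩
    exact ⟨o, f, L, ⟨h1, h2, h3, h4, h5, h6, h7, h8, h9, h10⟩⟩

/-! ### Second staging: the Euler count and the Lefschetz-free genus-one classification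

The natural proof of Hayano's rung factors through two printed results of different size, which
we record as separate named facts (Baykur 2012, p. 18: a genus-1 SBLF on a homotopy 4-sphere has
`k = 0` Lefschetz points by the Euler count, and the total spaces of genus-1 SBLFs without
Lefschetz points are classified exactly):

* the **Euler count** (Baykur 2012, Lemma 7: `e(X) = 6 - 4g + k`), read on a homotopy 4-sphere:
  a genus-`(h + 1)` SBLF of a homotopy 4-sphere has exactly `4h` Lefschetz points — an M/L-sized
  formalisation (Ehresmann off the critical image, `χ`-additivity over the three pieces), reusable
  by the higher rungs of route SblfDescent ("genus 2, exactly four Lefschetz points";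
  "necessarily `4h + 4`");
* the **Lefschetz-free genus-one classification** (Baykur–Kamada 2015, Lemma 11 with Cor. 14;
  Hayano 2011, Thm. 4.2): a closed simply connected 4-manifold with a genus-1 SBLF WITHOUT
  Lefschetz points is `S⁴` — the XL part, but now free of any theory of Lefschetz singularities
  (the total space is `T² × D² ∪ round 2-handle ∪ S² × D²`).

`RungOne` follows from the two by pure logic (`RungOne_of_eulerCount_of_noLefschetz`), and so does
the earlier single fact `nonempty_diffeomorph_sphere_four_of_sblf_genus_one` given the tree's
homotopy-sphere criterion `spc4.S10` (`nonempty_diffeomorph_sphere_four_of_sblf_genus_one_of`). -/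

/-- **`RungOne` modulo the Euler count and the Lefschetz-free genus-one classification.**  GIVEN
the named facts `card_eq_four_mul_of_sblf_of_homotopyEquiv_sphere_four` (Baykur 2012, Lemma 7 on a
homotopy 4-sphere) and `nonempty_diffeomorph_sphere_four_of_sblf_genus_one_noLefschetz`
(Baykur–Kamada 2015, Lemma 11 + Cor. 14; Hayano 2011, Thm. 4.2), the route decl `RungOne` holds:
for `e : M ≃ₕ S⁴` and the route's inline `HAS(M, 0)` repackaged as
`IsSimplifiedBrokenLefschetzFibration o f L 0`, the Euler count gives `L.card = 4 · 0 = 0`, so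
`L = ∅`; `M` is compact (`compactSpace_of_homotopyEquiv_sphere_four_holds`) and simply connected
(`simplyConnectedSpace_of_homotopyEquiv_sphere_four`), and the classification applies.  This is
the argument of Baykur 2012, p. 18 (only `S⁴` among homotopy 4-spheres has broken genus one).
CONDITIONAL result: credits nothing until both facts are discharged. [cite: Baykur2012, Lemma 7] -/
theorem RungOne_of_eulerCount_of_noLefschetz
    (hA : Literature.Topology.FourManifolds.card_eq_four_mul_of_sblf_of_homotopyEquiv_sphere_four)
    (hB : Literature.Topology.FourManifolds.nonempty_diffeomorph_sphere_four_of_sblf_genus_one_noLefschetz) :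
    Summit.SmoothPoincare4.SmoothPoincare4.Theses.SblfDescent.RungOne := by
  intro M _ _ _ _ _ e hM
  obtain ⟨o, f, L, h1, h2, h3, h4, h5, h6, h7, h8, h9, h10⟩ := hM
  have hS : Literature.Topology.FourManifolds.IsSimplifiedBrokenLefschetzFibration o f L 0 :=
    ⟨h1, h2, h3, h4, h5, h6, h7, h8, h9, h10⟩
  have hL : L = ∅ := Finset.card_eq_zero.mp (by simpa using hA M e o f L 0 hS)
  subst hL
  haveI : CompactSpace M :=
    Literature.Topology.FourManifolds.compactSpace_of_homotopyEquiv_sphere_four_holds M e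
  haveI : SimplyConnectedSpace M :=
    Literature.Topology.FourManifolds.simplyConnectedSpace_of_homotopyEquiv_sphere_four
      Literature.Topology.FourManifolds.simplyConnectedSpace_sphere_four_holds M e
  exact hB M ⟨o, f, hS⟩

/-- **The single fact `nonempty_diffeomorph_sphere_four_of_sblf_genus_one` from the two new ones
and the homotopy-sphere criterion.**  Hayano's Cor. 4.11 at `Q_X = 0` (the named fact
`nonempty_diffeomorph_sphere_four_of_sblf_genus_one`: a closed simply connected 4-manifold with
`H₂ = 0` and a genus-1 SBLF is `S⁴`) follows from the Euler count
(`card_eq_four_mul_of_sblf_of_homotopyEquiv_sphere_four`), the Lefschetz-free classification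
(`nonempty_diffeomorph_sphere_four_of_sblf_genus_one_noLefschetz`) and the tree's criterion
`spc4.S10` (`nonempty_homotopyEquiv_sphere_four_iff`: a closed 4-manifold is `≃ₕ S⁴` iff it is
simply connected with `H₂ = 0`; Freedman–Quinn 1990, §10.1, itself staged in
`HomotopyS4Criterion.lean` from Poincaré duality, Whitehead/Hurewicz and Milnor's CW type): the
criterion makes `X` a homotopy sphere, the Euler count empties `L`, the classification concludes.
So discharging the two new facts (and `spc4.S10`) discharges the old one. [cite: Baykur2012, Lemma 7] -/
theorem nonempty_diffeomorph_sphere_four_of_sblf_genus_one_of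
    (hA : Literature.Topology.FourManifolds.card_eq_four_mul_of_sblf_of_homotopyEquiv_sphere_four)
    (hB : Literature.Topology.FourManifolds.nonempty_diffeomorph_sphere_four_of_sblf_genus_one_noLefschetz)
    (hS10 : Literature.Topology.FourManifolds.nonempty_homotopyEquiv_sphere_four_iff.{0}) :
    Literature.Topology.FourManifolds.nonempty_diffeomorph_sphere_four_of_sblf_genus_one := by
  intro X _ _ _ _ _ _ _ hH2 hX
  obtain ⟨o, f, L, hS⟩ := hX
  obtain ⟨e⟩ := (hS10 X).mpr ⟨inferInstance, hH2⟩
  have hL : L = ∅ := Finset.card_eq_zero.mp (by simpa using hA X e o f L 0 hS)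
  subst hL
  exact hB X ⟨o, f, hS⟩

end Summit.SmoothPoincare4.SmoothPoincare4.Theorems
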